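import Summits.ResolutionOfSingularities.ResolutionOfSingularities.Theorems.HilbertSamuelEliminationCampaignW42FlatRegularFibreCone
import Summits.ResolutionOfSingularities.ResolutionOfSingularities.Theorems.HilbertSamuelEliminationCampaignW42PermissibleConeDictionary
import Mathlib.RingTheory.RegularLocalRing.Polynomial
import Mathlib.RingTheory.Localization.LocalizationLocalization
import Mathlib.RingTheory.MvPolynomial.Localization
import Mathlib.RingTheory.KrullDimension.Polynomial
import Mathlib.RingTheory.Ideal.Height
import Mathlib.RingTheory.Polynomial.Quotient
import Mathlib.RingTheory.Flat.Localization
import Literature.AlgebraicGeometry.Resolution.AffineDomainEquidim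
import HarnessLib

/-!
# [OURS · L1 W4.2] The TRANSCENDENTAL THICKENING of the local ring of a cone at a point: `O_{C,𝔓} → B := (T[Y])_𝔔` is flat
# with fibre `L[Y]_{(Y − x̄)}` (regular of dimension `n`), hence `H⁽⁰⁾(B) = H⁽ⁿ⁾(O_{C,𝔓})` and `dim F(B) = dim F(O_{C,𝔓}) + n`
# (Dietel (8.2.4)/(8.2.2), all transcendence at once; campaign s42, cell res-hironaka; informal crux `RidgeConfinement`,
# stmt-ResolutionOfSingularities-17845; `--supports`; brick B4 of the unconditional `RidgeDimMonotone`)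

HONEST FRAMING. OURS (slot W4.2, prover res-L1-s42-pv-1, gen 5). Setting: `K` a field, `S = K[X_1, …, X_n]`, `I ⊆ 𝔓 ⊆ S` with
`𝔓` prime, `T = S/I` (the cone `C = Spec T`), `D = S/𝔓` with fraction field `L = κ(𝔓)`, `x̄ ∈ Lⁿ` the images of the `X_i`.
Dietel's comparison (8.2.6) of the point `𝔓` of `C` with the vertex passes through the `L`-RATIONAL point `x̄` of the base-changed
cone `C_L`; to get there he base-changes along a transcendence basis of `L/K` ((8.2.4), one variable at a time) and then along a
tower of simple algebraic extensions ((8.2.3)). We replace both inductions by ONE thickening: the local ring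
`B = (T[Y_1, …, Y_n])_𝔔`, `𝔔 = ker(T[Y] → L : X_i ↦ x̄_i, Y_i ↦ x̄_i)`. This file establishes its FIRST structure:

* `ker_conePointMap_comap_C` — `𝔔 ∩ T = 𝔓/I`, so `O_{C,𝔓} = T_{𝔓/I} → B` (`Localization.localRingHom`);
* `B` is FLAT over `O_{C,𝔓}` (free polynomial extension, then localization) and its closed fibre `B/𝔓B` is the localization of
  `D[Y]` at the kernel of `D[Y] → L`, i.e. (fractions of `D` being units there) **`L[Y]_{(Y_i − x̄_i)}` — a REGULAR local ring
  of dimension `n`** (`isRegularLocalRing_thickening_fibre`, `ringKrullDim_thickening_fibre`);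
* hence, by the tree's `hilbertFun_eq_hilbertSamuelFun_of_flat_of_isRegularLocalRing_fiber` and this campaign's
  `localRidgeDim_eq_add_of_flat_of_isRegularLocalRing_fiber` (p534922): **`H⁽⁰⁾(B) = H⁽ⁿ⁾(O_{C,𝔓})`** and
  **`dim F(B) = dim F(O_{C,𝔓}) + n`** (`hilbertFun_thickening`, `localRidgeDim_thickening`).

The SECOND structure (`B/𝔓(Y)B ≅` the local ring of `C_L` at `x̄`, through the regular local ring `S_𝔓` of dimension
`n − dim S/𝔓`) and the cone lemma `dim F(O_{C,𝔓}) + dim S/𝔓 ≤ dim F(C)` follow in the sequel files. NOTHING here is a statement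
of H. Hironaka's manuscript [Hironaka2017]. AI review is weaker than expert review. References (orientation only): B. Dietel,
Dissertation Regensburg (2015), (8.2.2), (8.2.4), (8.2.6); V. Cossart, U. Jannsen, S. Saito, LNM 2270 (2020), Lemma 2.27,
proof of Thm. 3.10 (p. 47, the base change `𝔸¹_X → X`).
-/

noncomputable section

-- single-conjunct summit: the doubled namespace component `ResolutionOfSingularities` is mandated
set_option linter.dupNamespace false
-- localizations of polynomial rings over quotient rings: nested instance problems (as in the gen-3/4 files)
set_option maxSynthPendingDepth 3

open IsLocalRing MvPolynomial Module
open Literature.RingTheory.HilbertSamuel Literature.RingTheory.MvPolynomial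
open Literature.AlgebraicGeometry.Resolution

attribute [local instance] MvPolynomial.algebraMvPolynomial

namespace Summit.ResolutionOfSingularities.ResolutionOfSingularities.Theorems

namespace CampaignW42

universe u

/-! ## The regular local ring `L[Y]_{(Y − v)}` as a localization of `D[Y]`, `L = Frac D` -/

section RationalPointOverFractions

variable {D : Type u} [CommRing D] [IsDomain D] (L : Type u) [Field L] [Algebra D L] [IsFractionRing D L] {n : ℕ}
  (v : Fin n → L) [(RingHom.ker (eval v) : Ideal (MvPolynomial (Fin n) L)).IsPrime]

omit [IsDomain D] in
/-- **`L[Y]_{𝔪_v}` is the localization of `D[Y]` at `𝔪_v ∩ D[Y]`** for `L = Frac D` and a rational point `v ∈ Lⁿ`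
(`L[Y]` is the localization of `D[Y]` at `D ∖ 0`; localizing further at a prime is localizing `D[Y]` at its contraction).
[folklore] -/
theorem isLocalization_atPrime_localization_ker_eval :
    IsLocalization.AtPrime (Localization.AtPrime (RingHom.ker (eval v) : Ideal (MvPolynomial (Fin n) L)))
      ((RingHom.ker (eval v) : Ideal (MvPolynomial (Fin n) L)).comap
        (algebraMap (MvPolynomial (Fin n) D) (MvPolynomial (Fin n) L))) := by
  haveI : IsLocalization ((nonZeroDivisors D).map (C : D →+* MvPolynomial (Fin n) D)) (MvPolynomial (Fin n) L) :=
    MvPolynomial.isLocalization _ _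
  exact IsLocalization.isLocalization_isLocalization_atPrime_isLocalization
    ((nonZeroDivisors D).map (C : D →+* MvPolynomial (Fin n) D))
    (Localization.AtPrime (RingHom.ker (eval v) : Ideal (MvPolynomial (Fin n) L))) (RingHom.ker (eval v))

omit [IsDomain D] [Algebra D L] [IsFractionRing D L] in
/-- `L[Y]_{𝔪_v}` is a regular local ring (a localization of a polynomial ring over a field). [folklore] -/
theorem isRegularLocalRing_localization_ker_eval :
    IsRegularLocalRing (Localization.AtPrime (RingHom.ker (eval v) : Ideal (MvPolynomial (Fin n) L))) :=
  inferInstance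

omit [IsDomain D] [Algebra D L] [IsFractionRing D L] in
/-- `dim L[Y_1, …, Y_n]_{𝔪_v} = n` (`𝔪_v` is a maximal ideal of the `n`-dimensional affine domain `L[Y]`). [folklore] -/
theorem ringKrullDim_localization_ker_eval :
    ringKrullDim (Localization.AtPrime (RingHom.ker (eval v) : Ideal (MvPolynomial (Fin n) L))) = n := by
  haveI : (RingHom.ker (eval v) : Ideal (MvPolynomial (Fin n) L)).IsMaximal :=
    RingHom.ker_isMaximal_of_surjective (eval v) fun c => ⟨C c, eval_C c⟩
  rw [IsLocalization.AtPrime.ringKrullDim_eq_height (RingHom.ker (eval v) : Ideal (MvPolynomial (Fin n) L)),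
    height_eq_ringKrullDim_of_isMaximal L (RingHom.ker (eval v) : Ideal (MvPolynomial (Fin n) L)),
    MvPolynomial.ringKrullDim_of_isNoetherianRing, ringKrullDim_eq_zero_of_field, Nat.card_eq_fintype_card,
    Fintype.card_fin, zero_add]

end RationalPointOverFractions

/-! ## The thickening `B = (T[Y])_𝔔` of `O_{C,𝔓} = T_{𝔓/I}` -/

section Thickening

variable {K : Type u} [Field K] {n : ℕ} {I 𝔓 : Ideal (MvPolynomial (Fin n) K)} (hI𝔓 : I ≤ 𝔓)
  (L : Type u) [Field L] [Algebra (MvPolynomial (Fin n) K ⧸ 𝔓) L]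

/-- [notation] `T = S/I`, the coordinate ring of the cone. -/
local notation3 "T" => MvPolynomial (Fin n) K ⧸ I
/-- [notation] `D = S/𝔓`. -/
local notation3 "D" => MvPolynomial (Fin n) K ⧸ 𝔓
/-- [notation] `x̄ ∈ Lⁿ`, the images of the variables. -/
local notation3 "xbar" => fun i : Fin n => algebraMap (MvPolynomial (Fin n) K ⧸ 𝔓) L (Ideal.Quotient.mk 𝔓 (X i))
/-- [notation] `φ : T → D → L`. -/
local notation3 "φ" => (algebraMap (MvPolynomial (Fin n) K ⧸ 𝔓) L).comp (Ideal.Quotient.factor hI𝔓)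
/-- [notation] `ψ : T[Y] → L`, coefficients through `φ`, `Y_i ↦ x̄_i`; its kernel is the prime `𝔔`. -/
local notation3 "ψ" => eval₂Hom φ xbar
/-- [notation] `E = (𝔓/I)·T[Y]`, the ideal of `T[Y]` generated by the coefficients in `𝔓/I`. -/
local notation3 "E" => (𝔓.map (Ideal.Quotient.mk I)).map (C : T →+* MvPolynomial (Fin n) T)

/-- The kernel of `T → D = S/𝔓` is `𝔓/I`. [folklore] -/
theorem ker_factor_conePoint : RingHom.ker (Ideal.Quotient.factor hI𝔓) = 𝔓.map (Ideal.Quotient.mk I) := by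
  ext t
  obtain ⟨s, rfl⟩ := Ideal.Quotient.mk_surjective t
  rw [RingHom.mem_ker, Ideal.Quotient.factor_mk, Ideal.Quotient.eq_zero_iff_mem, Ideal.mem_quotient_iff_mem_sup,
    sup_eq_left.mpr hI𝔓]

variable [IsFractionRing (MvPolynomial (Fin n) K ⧸ 𝔓) L]

/-- The kernel of `φ : T → D → L` is `𝔓/I` (`D → L` is injective). [folklore] -/
theorem ker_conePointResidueMap : RingHom.ker φ = 𝔓.map (Ideal.Quotient.mk I) := by
  rw [← ker_factor_conePoint hI𝔓]
  ext t
  rw [RingHom.mem_ker, RingHom.mem_ker, RingHom.comp_apply, map_eq_zero_iff _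
    (IsFractionRing.injective (MvPolynomial (Fin n) K ⧸ 𝔓) L)]

omit [IsFractionRing (MvPolynomial (Fin n) K ⧸ 𝔓) L] in
/-- `ψ` on the polynomial `s(Y)` with `K`-coefficients is the image of `s` in `L = κ(𝔓)`. [folklore] -/
theorem conePointMap_map_algebraMap (s : MvPolynomial (Fin n) K) :
    ψ (MvPolynomial.map (algebraMap K T) s) =
      algebraMap (MvPolynomial (Fin n) K ⧸ 𝔓) L (Ideal.Quotient.mk 𝔓 s) := by
  rw [eval₂Hom_map_hom]
  have hcomp : ((algebraMap (MvPolynomial (Fin n) K ⧸ 𝔓) L).comp (Ideal.Quotient.factor hI𝔓)).comp (algebraMap K T) =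
      ((algebraMap (MvPolynomial (Fin n) K ⧸ 𝔓) L).comp (Ideal.Quotient.mk 𝔓)).comp C := by
    ext c; rfl
  rw [hcomp]
  change eval₂ (((algebraMap (MvPolynomial (Fin n) K ⧸ 𝔓) L).comp (Ideal.Quotient.mk 𝔓)).comp C) _ s = _
  induction s using MvPolynomial.induction_on with
  | C c => rw [eval₂_C]; rfl
  | add p q hp hq => rw [eval₂_add, hp, hq, map_add, map_add]
  | mul_X p i hp => rw [eval₂_mul, eval₂_X, hp, map_mul, map_mul]

/-- **`𝔔 ∩ T = 𝔓/I`**: a coefficient `t ∈ T` lies in `𝔔` iff `t ∈ 𝔓/I`. [folklore] -/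
theorem ker_conePointMap_comap_C :
    (RingHom.ker ψ).comap (C : T →+* MvPolynomial (Fin n) T) = 𝔓.map (Ideal.Quotient.mk I) := by
  rw [← ker_conePointResidueMap hI𝔓 L]
  ext t
  rw [Ideal.mem_comap, RingHom.mem_ker, RingHom.mem_ker, coe_eval₂Hom, eval₂_C]

/-- **`𝔔 ∩ S = 𝔓`** for the inclusion `S = K[Y] → T[Y]` of polynomials with constant coefficients. [folklore] -/
theorem ker_conePointMap_comap_map :
    (RingHom.ker ψ).comap (MvPolynomial.map (algebraMap K T)) = 𝔓 := by
  ext s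
  rw [Ideal.mem_comap, RingHom.mem_ker, conePointMap_map_algebraMap hI𝔓 L, map_eq_zero_iff _
    (IsFractionRing.injective (MvPolynomial (Fin n) K ⧸ 𝔓) L), Ideal.Quotient.eq_zero_iff_mem]

/-- `E ⊆ 𝔔`. [folklore] -/
theorem map_C_conePoint_le_ker : E ≤ RingHom.ker ψ := by
  rw [← ker_conePointMap_comap_C hI𝔓 L]
  exact Ideal.map_comap_le

omit [IsFractionRing (MvPolynomial (Fin n) K ⧸ 𝔓) L] in
/-- **`ψ` factors through the coefficientwise reduction `ρ : T[Y] → D[Y]`**: `ψ = (eval₂Hom (D → L) x̄) ∘ map(T → D)`.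
[folklore] -/
theorem conePointMap_eq_comp :
    ψ = (eval₂Hom (algebraMap D L) xbar).comp (MvPolynomial.map (Ideal.Quotient.factor hI𝔓)) := by
  refine ringHom_ext (fun t => ?_) (fun i => ?_)
  · simp only [RingHom.comp_apply, coe_eval₂Hom, eval₂_C, map_C]
  · simp only [RingHom.comp_apply, coe_eval₂Hom, eval₂_X, map_X]

omit [IsFractionRing (MvPolynomial (Fin n) K ⧸ 𝔓) L] in
/-- The kernel `𝔔_D` of `D[Y] → L`, `Y_i ↦ x̄_i`, is the contraction of `𝔪_{x̄} = ker(eval x̄) ⊆ L[Y]`. [folklore] -/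
theorem ker_eval₂Hom_eq_comap_ker_eval :
    RingHom.ker (eval₂Hom (algebraMap D L) xbar) =
      (RingHom.ker (eval xbar) : Ideal (MvPolynomial (Fin n) L)).comap
        (algebraMap (MvPolynomial (Fin n) D) (MvPolynomial (Fin n) L)) := by
  ext p
  rw [RingHom.mem_ker, Ideal.mem_comap, RingHom.mem_ker, MvPolynomial.algebraMap_def, coe_eval₂Hom, ← eval_map]

omit [IsFractionRing (MvPolynomial (Fin n) K ⧸ 𝔓) L] in
/-- `𝔔 = ρ⁻¹(𝔔_D)`. [folklore] -/
theorem ker_conePointMap_eq_comap :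
    RingHom.ker ψ = (RingHom.ker (eval₂Hom (algebraMap D L) xbar)).comap (MvPolynomial.map (Ideal.Quotient.factor hI𝔓)) := by
  rw [conePointMap_eq_comp hI𝔓 L, ← RingHom.comap_ker]

omit [IsFractionRing (MvPolynomial (Fin n) K ⧸ 𝔓) L] in
/-- The coefficientwise reduction `ρ : T[Y] → D[Y]` is surjective with kernel `E`. [folklore] -/
theorem ker_map_factor_eq : RingHom.ker (MvPolynomial.map (σ := Fin n) (Ideal.Quotient.factor hI𝔓)) = E := by
  rw [MvPolynomial.ker_map, ker_factor_conePoint hI𝔓]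

omit [IsFractionRing (MvPolynomial (Fin n) K ⧸ 𝔓) L] in
/-- `ρ` is surjective. [folklore] -/
theorem map_factor_surjective : Function.Surjective (MvPolynomial.map (σ := Fin n) (Ideal.Quotient.factor hI𝔓)) :=
  MvPolynomial.map_surjective _ (Ideal.Quotient.factor_surjective hI𝔓)

section Structure

variable {Q : Ideal (MvPolynomial (Fin n) (MvPolynomial (Fin n) K ⧸ I))} [Q.IsPrime]
  (hQ : Q = RingHom.ker (eval₂Hom ((algebraMap (MvPolynomial (Fin n) K ⧸ 𝔓) L).comp (Ideal.Quotient.factor hI𝔓))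
    (fun i : Fin n => algebraMap (MvPolynomial (Fin n) K ⧸ 𝔓) L (Ideal.Quotient.mk 𝔓 (X i)))))
  {P' : Ideal (MvPolynomial (Fin n) K ⧸ I)} [P'.IsPrime] (hP' : P' = 𝔓.map (Ideal.Quotient.mk I))

/-- [notation] the thickening `B = (T[Y])_𝔔`. -/
local notation3 "B" => Localization.AtPrime Q
/-- [notation] `O = O_{C,𝔓} = T_{𝔓/I}`. -/
local notation3 "O" => Localization.AtPrime P'

omit [Q.IsPrime] [P'.IsPrime] in
include hQ hP' in
/-- `P' = 𝔔 ∩ T` (the hypothesis of `Localization.localRingHom`). [folklore] -/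
theorem conePoint_eq_comap_C : P' = Q.comap (C : T →+* MvPolynomial (Fin n) T) := by
  rw [hQ, hP', ker_conePointMap_comap_C hI𝔓 L]

omit [Q.IsPrime] in
include hQ in
/-- `E ⊆ 𝔔`. [folklore] -/
theorem map_C_le_thickeningPrime : E ≤ Q := by rw [hQ]; exact map_C_conePoint_le_ker hI𝔓 L

/-- `θ ∘ (T → O) = (T[Y] → B) ∘ C`: the structure map `θ = localRingHom P' 𝔔 C` is compatible with the coefficients.
[folklore] -/
theorem thickeningMap_comp_algebraMap :
    (Localization.localRingHom P' Q (C : T →+* MvPolynomial (Fin n) T) (conePoint_eq_comap_C hI𝔓 L hQ hP')).comp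
        (algebraMap T O) = (algebraMap (MvPolynomial (Fin n) T) B).comp C := by
  refine RingHom.ext fun t => ?_
  rw [RingHom.comp_apply, RingHom.comp_apply, Localization.localRingHom_to_map]

/-- **`B` is flat over `O`** (via `θ`): `T[Y]` is free over `T`, `B` is a localization of `T[Y]`, and flatness over `T`
is flatness over the localization `O = T_{𝔓/I}`. [cite: Dietel2015, Lemma (8.2.4)] -/
theorem flat_thickening :
    letI : Algebra O B :=
      (Localization.localRingHom P' Q (C : T →+* MvPolynomial (Fin n) T) (conePoint_eq_comap_C hI𝔓 L hQ hP')).toAlgebra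
    Module.Flat O B := by
  letI : Algebra O B :=
    (Localization.localRingHom P' Q (C : T →+* MvPolynomial (Fin n) T) (conePoint_eq_comap_C hI𝔓 L hQ hP')).toAlgebra
  haveI : IsScalarTower T O B := IsScalarTower.of_algebraMap_eq fun t => by
    change _ = (Localization.localRingHom P' Q (C : T →+* MvPolynomial (Fin n) T) (conePoint_eq_comap_C hI𝔓 L hQ hP'))
      (algebraMap T O t)
    rw [← RingHom.comp_apply, thickeningMap_comp_algebraMap hI𝔓 L hQ hP', RingHom.comp_apply]
    exact IsScalarTower.algebraMap_apply T (MvPolynomial (Fin n) T) B t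
  haveI : Module.Flat T B := inferInstance
  exact (Module.flat_iff_of_isLocalization (S := O) P'.primeCompl (M := B)).mpr inferInstance

/-- `𝔪_O · B = E · B`. [folklore] -/
theorem map_maximalIdeal_thickening :
    (maximalIdeal O).map (Localization.localRingHom P' Q (C : T →+* MvPolynomial (Fin n) T)
      (conePoint_eq_comap_C hI𝔓 L hQ hP')) = (E).map (algebraMap (MvPolynomial (Fin n) T) B) := by
  rw [← Localization.AtPrime.map_eq_maximalIdeal, Ideal.map_map, thickeningMap_comp_algebraMap hI𝔓 L hQ hP',
    ← Ideal.map_map, hP']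

include hQ in
/-- **The closed fibre `B/EB` is `L[Y]_{(Y − x̄)}`**: `B/EB` is the localization of `T[Y]/E ≅ D[Y]` at `𝔔/E ↔ 𝔔_D`, and
`L[Y]_{𝔪_{x̄}}` is the localization of `D[Y]` at `𝔔_D` (fractions of `D` are units there). [cite: Dietel2015, Lemma (8.2.4)] -/
theorem nonempty_ringEquiv_thickening_fibre [hQL : (RingHom.ker (eval xbar) : Ideal (MvPolynomial (Fin n) L)).IsPrime] :
    Nonempty ((B ⧸ (E).map (algebraMap (MvPolynomial (Fin n) T) B)) ≃+*
      Localization.AtPrime (RingHom.ker (eval xbar) : Ideal (MvPolynomial (Fin n) L))) := by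
  -- `T[Y]/E ≅ D[Y]` along `ρ = map(T → D)`
  have hker : E = RingHom.ker (MvPolynomial.map (σ := Fin n) (Ideal.Quotient.factor hI𝔓)) := (ker_map_factor_eq hI𝔓).symm
  have hsurj := map_factor_surjective (n := n) hI𝔓
  let e : (MvPolynomial (Fin n) T ⧸ E) ≃+* MvPolynomial (Fin n) D :=
    (Ideal.quotEquivOfEq hker).trans (RingHom.quotientKerEquivOfSurjective hsurj)
  have hecomp : e.toRingHom.comp (Ideal.Quotient.mk E) = MvPolynomial.map (Ideal.Quotient.factor hI𝔓) := by
    refine RingHom.ext fun p => ?_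
    rfl
  set Loc := Localization.AtPrime (RingHom.ker (eval xbar) : Ideal (MvPolynomial (Fin n) L))
  -- `𝔔_D` is prime and `Loc` is the localization of `D[Y]` at it
  set QD : Ideal (MvPolynomial (Fin n) D) := (RingHom.ker (eval xbar) : Ideal (MvPolynomial (Fin n) L)).comap
    (algebraMap (MvPolynomial (Fin n) D) (MvPolynomial (Fin n) L)) with hQD
  haveI hQDp : QD.IsPrime := Ideal.IsPrime.comap _
  haveI hloc : IsLocalization.AtPrime Loc QD := isLocalization_atPrime_localization_ker_eval L _
  -- `B/EB` is the localization of `U/E` at `𝔔/E`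
  haveI hE := isPrime_map_quotientMk_of_le (map_C_le_thickeningPrime hI𝔓 L hQ)
  haveI hBloc : IsLocalization.AtPrime (B ⧸ (E).map (algebraMap (MvPolynomial (Fin n) T) B)) (Q.map (Ideal.Quotient.mk E)) :=
    isLocalization_atPrime_quotient_mapExt_of_le (map_C_le_thickeningPrime hI𝔓 L hQ) B
  -- transport the localization structure of `Loc` along `e`
  have hQ' : Q.map (Ideal.Quotient.mk E) = QD.comap e.toRingHom := by
    refine Ideal.comap_injective_of_surjective (Ideal.Quotient.mk E) Ideal.Quotient.mk_surjective ?_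
    rw [Ideal.comap_map_of_surjective _ Ideal.Quotient.mk_surjective, ← RingHom.ker_eq_comap_bot, Ideal.mk_ker,
      sup_eq_left.mpr (map_C_le_thickeningPrime hI𝔓 L hQ), Ideal.comap_comap, hecomp, hQD,
      ← ker_eval₂Hom_eq_comap_ker_eval L, ← ker_conePointMap_eq_comap hI𝔓 L, hQ]
  letI : Algebra (MvPolynomial (Fin n) T ⧸ E) Loc := ((algebraMap (MvPolynomial (Fin n) D) Loc).comp e.toRingHom).toAlgebra
  haveI : IsLocalization.AtPrime Loc (Q.map (Ideal.Quotient.mk E)) :=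
    isLocalization_atPrime_comap_of_ringEquiv e QD _ hQ'
  exact ⟨(IsLocalization.algEquiv (Q.map (Ideal.Quotient.mk E)).primeCompl
    (B ⧸ (E).map (algebraMap (MvPolynomial (Fin n) T) B)) Loc).toRingEquiv⟩

/-- **The closed fibre of `O → B` is a regular local ring of dimension `n`.** [cite: Dietel2015, Lemma (8.2.4), Prop. (8.2.2)] -/
theorem isRegularLocalRing_thickening_fibre :
    letI : Algebra O B :=
      (Localization.localRingHom P' Q (C : T →+* MvPolynomial (Fin n) T) (conePoint_eq_comap_C hI𝔓 L hQ hP')).toAlgebra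
    IsRegularLocalRing (B ⧸ (maximalIdeal O).map (algebraMap O B)) ∧
      ringKrullDim (B ⧸ (maximalIdeal O).map (algebraMap O B)) = n := by
  haveI hQL : (RingHom.ker (eval xbar) : Ideal (MvPolynomial (Fin n) L)).IsPrime := RingHom.ker_isPrime _
  obtain ⟨e⟩ := nonempty_ringEquiv_thickening_fibre hI𝔓 L hQ
  have hm := map_maximalIdeal_thickening hI𝔓 L hQ hP'
  let e' := (Ideal.quotEquivOfEq hm).trans e
  haveI := isRegularLocalRing_localization_ker_eval L xbar
  exact ⟨IsRegularLocalRing.of_ringEquiv e'.symm, by rw [ringKrullDim_eq_of_ringEquiv e', ringKrullDim_localization_ker_eval L]⟩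

include hI𝔓 L hQ hP' in
/-- **`H⁽⁰⁾(B) = H⁽ⁿ⁾(O_{C,𝔓})`** for the thickening (tree: flat with regular fibre of dimension `n`).
[cite: Dietel2015, Lemma (8.2.4), (8.2.6.D)] [cite: CossartJannsenSaito2020, Lemma 2.27 (2)] -/
theorem hilbertFun_thickening : hilbertFun B = hilbertSamuelFun O n := by
  letI : Algebra O B :=
    (Localization.localRingHom P' Q (C : T →+* MvPolynomial (Fin n) T) (conePoint_eq_comap_C hI𝔓 L hQ hP')).toAlgebra
  haveI := flat_thickening hI𝔓 L hQ hP'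
  obtain ⟨hreg, hdim⟩ := isRegularLocalRing_thickening_fibre hI𝔓 L hQ hP'
  haveI := hreg
  exact hilbertFun_eq_hilbertSamuelFun_of_flat_of_isRegularLocalRing_fiber hdim

include hI𝔓 L hQ hP' in
/-- **`dim F(B) = dim F(O_{C,𝔓}) + n`** for the thickening (`…CampaignW42FlatRegularFibreCone`). [cite: Dietel2015, (8.2.6.D)] -/
theorem localRidgeDim_thickening : localRidgeDim B = localRidgeDim O + n := by
  letI : Algebra O B :=
    (Localization.localRingHom P' Q (C : T →+* MvPolynomial (Fin n) T) (conePoint_eq_comap_C hI𝔓 L hQ hP')).toAlgebra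
  haveI := flat_thickening hI𝔓 L hQ hP'
  haveI : IsLocalHom (algebraMap O B) := Localization.isLocalHom_localRingHom _ _ _ _
  obtain ⟨hreg, hdim⟩ := isRegularLocalRing_thickening_fibre hI𝔓 L hQ hP'
  haveI := hreg
  exact localRidgeDim_eq_add_of_flat_of_isRegularLocalRing_fiber hdim

end Structure

end Thickening

end CampaignW42

end Summit.ResolutionOfSingularities.ResolutionOfSingularities.Theorems

end
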